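import Summits.AtomisticToContinuum.HydrodynamicLimit.Theorems.InformationPercolationEngineChaosClosesEulerMassBalance
import Literature.Analysis.FluidPDE.HardSphereFreeStretch
import HarnessLib

/-!
# The exact pathwise continuity equation of the cone-mollified empirical density, `C¹` space-time tests

WHAT. Stub `stub_massBalanceC1` of line `Sketch` of the crux `InformationPercolationEngine.ChaosClosesEuler`
(stmt-AtomisticToContinuum-15141): along ONE good orbit `s ↦ Φ.flow s z` of the hard-sphere flow on `𝕋³`, the
`r`-cone-mollified empirical density `ρ_r` and momentum `m_r` satisfy `∂ₛρ_r + div m_r = 0` exactly, in the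
weak-in-`x`, integrated-in-time form tested against a space-time `φ` whose space-time lift is only `C¹`:
`∫φ(t)ρ_r(t) − ∫φ(0)ρ_r(0) = ∫₀ᵗ ∫ (∂ₛφ ρ_r + m_r·∇φ)`. This is the `C¹` companion of the landed
`Theorems.ChaosClosesEulerMassBalance.stub_massBalance` (same statement with `Torus.IsSmoothSpaceTimeOn univ φ`).

WHY. The deterministic BF18 shell of the line tests the continuity equation with `½|ũ|² − μ(ρ̃, θ̃)`, which is only
`C¹` in space-time; the smooth version does not apply. The identity is DETERMINISTIC (Bogolyubov's exact weak
equation for the empirical measure of one trajectory, mass component; Pulvirenti–Simonella, arXiv:1504.03215 §1,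
(1.3)–(1.5): between collisions the empirical measure is transported freely, and collisions move no mass).

PROOF. Verbatim the proof of the smooth version, whose regularity lemmas use smoothness only through
`Differentiable ℝ (stLift φ)` and `Continuous (fderiv ℝ (stLift φ))`, both available at order `1`. The cone
`b_r(y, x) = 3/(πr³)(1 − d(y,x)/r)₊` depends on the torus difference only, `b_r(y,x) = h(x − y)`, so NO derivative
ever falls on the Lipschitz cone: by translation invariance of the Haar measure,
`∫ φ(s,x) h(x − y(s)) dx = ∫ φ(s, u + y(s)) h(u) du`, and along a free flight `y(s) = y₀ + proj((s−a)v)` the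
`s`-dependence sits in the `C¹` factor; the chain rule through the space-time lift (`fderiv_stLift_one`,
`hasDerivAt_comp_freeFlight`) and dominated differentiation on the compact torus (`hasDerivAt_integral_freeFlight`)
give the transport derivative `∫ (∂ₛφ + ∑ₖ vₖ∂ₖφ) h(x − y(s)) dx`, continuous in `s`. On an inter-collision interval
positions follow the free flight with endpoints included and velocities are frozen off the right endpoint, so the
fundamental theorem of calculus gives the balance on each free stretch (`ftc_free`); induction on the finite number
of collision times in `(a, b)` glues the stretches (`ftc_pieces`); `stub_massBalanceC1` unfolds the empirical
integrals and rearranges the finite sums. The `φ`-independent lemmas (`integral_mul_comp_sub`, `pos_eq_of_free`,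
`vel_eq_of_free`, `integral_empiricalMeasure_smul`) are reused from the smooth file.

No named fact is invoked.
-/

noncomputable section

namespace Summit.AtomisticToContinuum.HydrodynamicLimit.Theorems.ChaosClosesEulerMassBalanceC1

open scoped BigOperators Topology Classical MeasureTheory ENNReal InnerProductSpace
open Filter Set MeasureTheory
open Literature.MathematicalPhysics.KineticTheory
open Literature.Analysis.FluidPDE
open Summit.AtomisticToContinuum.HydrodynamicLimit.Theorems.ChaosClosesEulerMassBalance
  (integral_mul_comp_sub vel_eq_of_free pos_eq_of_free integral_empiricalMeasure_smul)

section Calculus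

open Literature.Analysis.FunctionSpaces

/-- A time slice of a space-time field with `C¹` lift is `C¹` on the torus (compose the lift with `y ↦ (s, y)`).
[folklore] -/
theorem isContDiff_slice {φ : ℝ → T3 → ℝ} (hφ : ContDiff ℝ 1 (Torus.stLift φ)) (s : ℝ) :
    Torus.IsContDiff 1 (φ s) := by
  change ContDiff ℝ 1 (Torus.stLift φ ∘ fun y : V3 => (s, y))
  exact hφ.comp (contDiff_prodMk_right s)

/-- A time slice of a space-time field with `C¹` lift is continuous. [folklore] -/
theorem continuous_slice {φ : ℝ → T3 → ℝ} (hφ : ContDiff ℝ 1 (Torus.stLift φ)) (s : ℝ) :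
    Continuous (φ s) :=
  (isContDiff_slice hφ s).continuous

/-- The time derivative of a `C¹` space-time field is the derivative of its lift in the direction `(1, 0)`.
[folklore] -/
theorem hasDerivAt_time_stLift {φ : ℝ → T3 → ℝ} (hφ : ContDiff ℝ 1 (Torus.stLift φ)) (s : ℝ) (ξ : V3) :
    HasDerivAt (fun s' => φ s' (Torus.proj ξ)) (fderiv ℝ (Torus.stLift φ) (s, ξ) ((1 : ℝ), (0 : V3))) s :=
  (hφ.differentiable one_ne_zero).differentiableAt.hasFDerivAt.comp_hasDerivAt s
    ((hasDerivAt_id s).prodMk (hasDerivAt_const s ξ))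

/-- The space derivative of a time slice is the derivative of the lift in the direction `(0, w)`. [folklore] -/
theorem torusFderiv_slice_eq {φ : ℝ → T3 → ℝ} (hφ : ContDiff ℝ 1 (Torus.stLift φ)) (s : ℝ) (ξ w : V3) :
    Torus.fderiv (φ s) (Torus.proj ξ) w = fderiv ℝ (Torus.stLift φ) (s, ξ) ((0 : ℝ), w) := by
  have hcomp : HasFDerivAt (Torus.lift (φ s)) ((fderiv ℝ (Torus.stLift φ) (s, ξ)).comp
      (ContinuousLinearMap.inr ℝ ℝ V3)) ξ :=
    (hφ.differentiable one_ne_zero).differentiableAt.hasFDerivAt.comp ξ (hasFDerivAt_prodMk_right s ξ)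
  rw [← Torus.fderiv_lift, hcomp.fderiv]
  rfl

/-- **Chain rule along a line.** For a `C¹` space-time field `φ` and a velocity `v`, the derivative of the lift in
the direction `(1, v)` is `∂ₛφ + ∑ₖ vₖ ∂ₖφ` read on the torus. [folklore] -/
theorem fderiv_stLift_one {φ : ℝ → T3 → ℝ} (hφ : ContDiff ℝ 1 (Torus.stLift φ)) (v : V3) (s : ℝ) (ξ : V3) :
    fderiv ℝ (Torus.stLift φ) (s, ξ) ((1 : ℝ), v) =
      deriv (fun s' => φ s' (Torus.proj ξ)) s + ∑ k : Fin 3, v k * Torus.partialDeriv k (φ s) (Torus.proj ξ) := by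
  have h1 : ((1 : ℝ), v) = ((1 : ℝ), (0 : V3)) + ((0 : ℝ), v) := by simp
  rw [h1, map_add, (hasDerivAt_time_stLift hφ s ξ).deriv]
  congr 1
  have hs1 : Torus.IsContDiff 1 (φ s) := isContDiff_slice hφ s
  have hv : v = ∑ k : Fin 3, v k • EuclideanSpace.single k (1 : ℝ) := by
    conv_lhs => rw [← (EuclideanSpace.basisFun (Fin 3) ℝ).sum_repr v]
    simp
  rw [← torusFderiv_slice_eq hφ s ξ v]
  conv_lhs => rw [hv]
  rw [map_sum]
  refine Finset.sum_congr rfl fun k _ => ?_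
  rw [map_smul, smul_eq_mul, Torus.partialDeriv_eq_fderiv_apply hs1]

/-- The transport derivative `(s, x) ↦ ∂ₛφ(s, x) + ∑ₖ vₖ ∂ₖφ(s, ·)(x)` of a `C¹` space-time field is jointly
continuous (it lifts to `Dφ̃(s, ξ)(1, v)` through the open quotient map `id × proj`). [folklore] -/
theorem continuous_transportDeriv {φ : ℝ → T3 → ℝ} (hφ : ContDiff ℝ 1 (Torus.stLift φ)) (v : V3) :
    Continuous fun p : ℝ × T3 =>
      deriv (fun s' => φ s' p.2) p.1 + ∑ k : Fin 3, v k * Torus.partialDeriv k (φ p.1) p.2 := by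
  have hq : IsOpenQuotientMap (Prod.map (id : ℝ → ℝ) (Torus.proj : V3 → T3)) :=
    IsOpenQuotientMap.id.prodMap Torus.isOpenQuotientMap_proj
  rw [← hq.continuous_comp_iff]
  have heq : ((fun p : ℝ × T3 =>
      deriv (fun s' => φ s' p.2) p.1 + ∑ k : Fin 3, v k * Torus.partialDeriv k (φ p.1) p.2) ∘
        Prod.map (id : ℝ → ℝ) (Torus.proj : V3 → T3)) =
      fun q : ℝ × V3 => fderiv ℝ (Torus.stLift φ) q ((1 : ℝ), v) := by
    funext q
    simp only [Function.comp_apply, Prod.map_fst, Prod.map_snd, id_eq]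
    exact (fderiv_stLift_one hφ v q.1 q.2).symm
  rw [heq]
  exact (hφ.continuous_fderiv one_ne_zero).clm_apply continuous_const

/-- **Chain rule along a free flight.** `s ↦ φ(s, x₀ + proj((s − a)v))` has derivative `∂ₛφ + ∑ₖ vₖ ∂ₖφ` at the
moving point, for a `C¹` space-time field. [folklore] -/
theorem hasDerivAt_comp_freeFlight {φ : ℝ → T3 → ℝ} (hφ : ContDiff ℝ 1 (Torus.stLift φ)) (x₀ : T3)
    (v : V3) (a s : ℝ) :
    HasDerivAt (fun s' => φ s' (x₀ + Torus.proj ((s' - a) • v)))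
      (deriv (fun s' => φ s' (x₀ + Torus.proj ((s - a) • v))) s
        + ∑ k : Fin 3, v k * Torus.partialDeriv k (φ s) (x₀ + Torus.proj ((s - a) • v))) s := by
  obtain ⟨ξ₀, hξ₀⟩ := Torus.proj_surjective x₀
  have hpt : ∀ s' : ℝ, x₀ + Torus.proj ((s' - a) • v) = Torus.proj (ξ₀ + (s' - a) • v) := by
    intro s'
    rw [Torus.proj_add, hξ₀]
  have hfun : (fun s' => φ s' (x₀ + Torus.proj ((s' - a) • v))) =
      Torus.stLift φ ∘ fun s' => (s', ξ₀ + (s' - a) • v) := by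
    funext s'
    simp only [Function.comp_apply, Torus.stLift_apply, hpt]
  have hι : HasDerivAt (fun s' : ℝ => (s', ξ₀ + (s' - a) • v)) ((1 : ℝ), v) s := by
    refine (hasDerivAt_id s).prodMk ?_
    simpa using (((hasDerivAt_id s).sub_const a).smul_const v).const_add ξ₀
  rw [hfun]
  refine ((hφ.differentiable one_ne_zero).differentiableAt.hasFDerivAt.comp_hasDerivAt s hι).congr_deriv ?_
  rw [fderiv_stLift_one hφ v s, ← hpt]

/-- The transport derivative of a `C¹` space-time field integrated against a recentred continuous kernel is
continuous in time. [folklore] -/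
theorem continuous_integral_transportDeriv {φ : ℝ → T3 → ℝ} (hφ : ContDiff ℝ 1 (Torus.stLift φ))
    {h : T3 → ℝ} (hh : Continuous h) (y₀ : T3) (v : V3) (a : ℝ) :
    Continuous fun s => ∫ x, (deriv (fun s' => φ s' x) s + ∑ k : Fin 3, v k * Torus.partialDeriv k (φ s) x)
        * h (x - (y₀ + Torus.proj ((s - a) • v))) := by
  have hy : Continuous fun s : ℝ => y₀ + Torus.proj ((s - a) • v) :=
    continuous_const.add (Torus.continuous_proj.comp ((continuous_id.sub continuous_const).smul continuous_const))
  have hint : Continuous (Function.uncurry fun (s : ℝ) (x : T3) =>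
      (deriv (fun s' => φ s' x) s + ∑ k : Fin 3, v k * Torus.partialDeriv k (φ s) x)
        * h (x - (y₀ + Torus.proj ((s - a) • v)))) := by
    show Continuous fun p : ℝ × T3 =>
      (deriv (fun s' => φ s' p.2) p.1 + ∑ k : Fin 3, v k * Torus.partialDeriv k (φ p.1) p.2)
        * h (p.2 - (y₀ + Torus.proj ((p.1 - a) • v)))
    exact (continuous_transportDeriv hφ v).mul (hh.comp (continuous_snd.sub (hy.comp continuous_fst)))
  simpa only [Measure.restrict_univ] using
    continuous_parametric_integral_of_continuous (μ := (volume : Measure T3)) hint isCompact_univ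

/-- **Differentiation under the integral sign along a free flight.** For a `C¹` space-time `φ`, a continuous
kernel `h` and the free flight `y(s) = y₀ + proj((s − a)v)`, the pairing `s ↦ ∫ φ(s, x) h(x − y(s)) dx` is
differentiable with derivative `∫ (∂ₛφ + ∑ₖ vₖ∂ₖφ)(s, x) h(x − y(s)) dx` (recentre by translation invariance, then
dominated differentiation on the compact torus). [folklore] -/
theorem hasDerivAt_integral_freeFlight {φ : ℝ → T3 → ℝ} (hφ : ContDiff ℝ 1 (Torus.stLift φ))
    {h : T3 → ℝ} (hh : Continuous h) (y₀ : T3) (v : V3) (a s : ℝ) :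
    HasDerivAt (fun s' => ∫ x, φ s' x * h (x - (y₀ + Torus.proj ((s' - a) • v))))
      (∫ x, (deriv (fun s' => φ s' x) s + ∑ k : Fin 3, v k * Torus.partialDeriv k (φ s) x)
        * h (x - (y₀ + Torus.proj ((s - a) • v)))) s := by
  have hrew : (fun s' => ∫ x, φ s' x * h (x - (y₀ + Torus.proj ((s' - a) • v)))) =
      fun s' => ∫ u, φ s' (u + y₀ + Torus.proj ((s' - a) • v)) * h u := by
    funext s'
    rw [integral_mul_comp_sub (φ s') h]
    simp only [add_assoc]
  have hrew' : (∫ x, (deriv (fun s' => φ s' x) s + ∑ k : Fin 3, v k * Torus.partialDeriv k (φ s) x)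
        * h (x - (y₀ + Torus.proj ((s - a) • v)))) =
      ∫ u, (deriv (fun s' => φ s' (u + y₀ + Torus.proj ((s - a) • v))) s
        + ∑ k : Fin 3, v k * Torus.partialDeriv k (φ s) (u + y₀ + Torus.proj ((s - a) • v))) * h u := by
    rw [integral_mul_comp_sub
      (fun x => deriv (fun s' => φ s' x) s + ∑ k : Fin 3, v k * Torus.partialDeriv k (φ s) x) h]
    simp only [add_assoc]
  rw [hrew, hrew']
  have hD := continuous_transportDeriv hφ v
  have hφc : ∀ s' : ℝ, Continuous (φ s') := fun s' => continuous_slice hφ s'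
  have hmove : ∀ s' : ℝ, Continuous fun u : T3 => u + y₀ + Torus.proj ((s' - a) • v) := fun s' =>
    (continuous_id.add continuous_const).add continuous_const
  -- a uniform bound of the transport derivative on `closedBall s 1 × 𝕋³`
  obtain ⟨M, hM⟩ := ((isCompact_closedBall s 1).prod (isCompact_univ (X := T3))).exists_bound_of_continuousOn
    hD.continuousOn
  refine (hasDerivAt_integral_of_dominated_loc_of_deriv_le (μ := (volume : Measure T3))
    (F := fun (s' : ℝ) (u : T3) => φ s' (u + y₀ + Torus.proj ((s' - a) • v)) * h u)
    (F' := fun (s' : ℝ) (u : T3) => (deriv (fun s'' => φ s'' (u + y₀ + Torus.proj ((s' - a) • v))) s'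
        + ∑ k : Fin 3, v k * Torus.partialDeriv k (φ s') (u + y₀ + Torus.proj ((s' - a) • v))) * h u)
    (x₀ := s) (bound := fun u => M * ‖h u‖) (Metric.closedBall_mem_nhds s one_pos) ?_ ?_ ?_ ?_ ?_ ?_).2
  · exact Filter.Eventually.of_forall fun s' => (((hφc s').comp (hmove s')).mul hh).aestronglyMeasurable
  · exact integrable_of_continuous_T3 (((hφc s).comp (hmove s)).mul hh)
  · exact ((hD.comp (continuous_const.prodMk (hmove s))).mul hh).aestronglyMeasurable
  · refine ae_of_all _ fun u s' hs' => ?_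
    rw [norm_mul]
    exact mul_le_mul_of_nonneg_right (hM (s', u + y₀ + Torus.proj ((s' - a) • v)) ⟨hs', Set.mem_univ _⟩)
      (norm_nonneg _)
  · exact (integrable_of_continuous_T3 hh).norm.const_mul M
  · exact ae_of_all _ fun u s' _ => (hasDerivAt_comp_freeFlight hφ (u + y₀) v a s').mul_const (h u)

end Calculus

section Trajectory

open Literature.Analysis.FunctionSpaces

variable {n : ℕ} {ε : ℝ} {γ : ℝ → Config n (Fin 3) T3}

/-- **Mass balance on a free stretch, `C¹` tests.** On a time interval `[a, b]` without collision in `(a, b)`, the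
pairing of a `C¹` space-time `φ` with the superposition of recentred kernels `∑ᵢ h(· − xᵢ(s))` is differentiable
with the transport derivative, which is continuous; the fundamental theorem of calculus gives the integrated
balance, and the trajectory integrand (which reads the actual velocities) agrees with it off the endpoints.
[folklore] -/
theorem ftc_free (hγ : IsHardSphereTrajectory (Torus.geometry (Fin 3)) ε n γ)
    {φ : ℝ → T3 → ℝ} (hφ : ContDiff ℝ 1 (Torus.stLift φ)) {h : T3 → ℝ} (hh : Continuous h)
    {a b : ℝ} (hab : a ≤ b) (hfree : ∀ τ ∈ Set.Ioo a b, τ ∉ collisionTimes (Torus.geometry (Fin 3)) ε γ) :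
    IntervalIntegrable (fun s => ∫ x, ∑ i, (deriv (fun s' => φ s' x) s
        + ∑ k : Fin 3, (γ s i).2 k * Torus.partialDeriv k (φ s) x) * h (x - (γ s i).1)) volume a b ∧
    ∫ s in a..b, (∫ x, ∑ i, (deriv (fun s' => φ s' x) s
        + ∑ k : Fin 3, (γ s i).2 k * Torus.partialDeriv k (φ s) x) * h (x - (γ s i).1)) =
      (∫ x, φ b x * ∑ i, h (x - (γ b i).1)) - ∫ x, φ a x * ∑ i, h (x - (γ a i).1) := by
  have hφc : ∀ s' : ℝ, Continuous (φ s') := fun s' => continuous_slice hφ s'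
  have hpos : ∀ s ∈ Set.Icc a b, ∀ i, (γ s i).1 = (γ a i).1 + Torus.proj ((s - a) • (γ a i).2) :=
    fun s hs i => pos_eq_of_free hγ hfree hs i
  have hvel : ∀ s ∈ Set.Ico a b, ∀ i, (γ s i).2 = (γ a i).2 := fun s hs i => vel_eq_of_free hγ hfree hs i
  -- the sum over particles of the free-flight pairings, its derivative, FTC
  have hsum : ∀ s, HasDerivAt
      (fun s' => ∑ i, ∫ x, φ s' x * h (x - ((γ a i).1 + Torus.proj ((s' - a) • (γ a i).2))))
      (∑ i, ∫ x, (deriv (fun s' => φ s' x) s + ∑ k : Fin 3, (γ a i).2 k * Torus.partialDeriv k (φ s) x)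
        * h (x - ((γ a i).1 + Torus.proj ((s - a) • (γ a i).2)))) s :=
    fun s => HasDerivAt.fun_sum fun i _ => hasDerivAt_integral_freeFlight hφ hh (γ a i).1 (γ a i).2 a s
  have hsumc : Continuous fun s => ∑ i, ∫ x, (deriv (fun s' => φ s' x) s
      + ∑ k : Fin 3, (γ a i).2 k * Torus.partialDeriv k (φ s) x)
        * h (x - ((γ a i).1 + Torus.proj ((s - a) • (γ a i).2))) :=
    continuous_finsetSum _ fun i _ => continuous_integral_transportDeriv hφ hh (γ a i).1 (γ a i).2 a
  have hftc := intervalIntegral.integral_eq_sub_of_hasDerivAt (fun s _ => hsum s) (hsumc.intervalIntegrable a b)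
  -- identification with the trajectory functionals
  have hF : ∀ s ∈ Set.Icc a b, (∫ x, φ s x * ∑ i, h (x - (γ s i).1)) =
      ∑ i, ∫ x, φ s x * h (x - ((γ a i).1 + Torus.proj ((s - a) • (γ a i).2))) := by
    intro s hs
    rw [← integral_finsetSum]
    · refine integral_congr_ae (ae_of_all _ fun x => ?_)
      show φ s x * ∑ i, h (x - (γ s i).1) = ∑ i, φ s x * h (x - ((γ a i).1 + Torus.proj ((s - a) • (γ a i).2)))
      rw [Finset.mul_sum]
      exact Finset.sum_congr rfl fun i _ => by rw [hpos s hs i]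
    · exact fun i _ => integrable_of_continuous_T3 ((hφc s).mul (hh.comp (continuous_id.sub continuous_const)))
  have hR : Set.EqOn (fun s => ∫ x, ∑ i, (deriv (fun s' => φ s' x) s
        + ∑ k : Fin 3, (γ s i).2 k * Torus.partialDeriv k (φ s) x) * h (x - (γ s i).1))
      (fun s => ∑ i, ∫ x, (deriv (fun s' => φ s' x) s
        + ∑ k : Fin 3, (γ a i).2 k * Torus.partialDeriv k (φ s) x)
          * h (x - ((γ a i).1 + Torus.proj ((s - a) • (γ a i).2)))) (Set.uIoo a b) := by
    intro s hs
    rw [Set.uIoo_of_le hab] at hs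
    show (∫ x, ∑ i, (deriv (fun s' => φ s' x) s
        + ∑ k : Fin 3, (γ s i).2 k * Torus.partialDeriv k (φ s) x) * h (x - (γ s i).1)) =
      ∑ i, ∫ x, (deriv (fun s' => φ s' x) s
        + ∑ k : Fin 3, (γ a i).2 k * Torus.partialDeriv k (φ s) x)
          * h (x - ((γ a i).1 + Torus.proj ((s - a) • (γ a i).2)))
    rw [← integral_finsetSum]
    · refine integral_congr_ae (ae_of_all _ fun x => Finset.sum_congr rfl fun i _ => ?_)
      rw [hpos s ⟨hs.1.le, hs.2.le⟩ i, hvel s ⟨hs.1.le, hs.2⟩ i]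
    · exact fun i _ => integrable_of_continuous_T3 (((continuous_transportDeriv hφ _).comp
        (continuous_const.prodMk continuous_id)).mul (hh.comp (continuous_id.sub continuous_const)))
  refine ⟨(hsumc.intervalIntegrable a b).congr_uIoo hR.symm, ?_⟩
  rw [intervalIntegral.integral_congr_uIoo hR, hftc, hF b ⟨hab, le_rfl⟩, hF a ⟨le_rfl, hab⟩]

/-- **Mass balance along a hard-sphere trajectory, piece by piece, `C¹` tests.** Induction on the number of
collision times in `(a, b)`: the free-stretch identity `ftc_free` on each inter-collision interval, glued additively
(collisions move no mass: positions are continuous, only velocities jump). [folklore] -/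
theorem ftc_pieces (hγ : IsHardSphereTrajectory (Torus.geometry (Fin 3)) ε n γ)
    {φ : ℝ → T3 → ℝ} (hφ : ContDiff ℝ 1 (Torus.stLift φ)) {h : T3 → ℝ} (hh : Continuous h) :
    ∀ (m : ℕ) {a b : ℝ}, a ≤ b → (collisionTimes (Torus.geometry (Fin 3)) ε γ ∩ Set.Ioo a b).ncard ≤ m →
    IntervalIntegrable (fun s => ∫ x, ∑ i, (deriv (fun s' => φ s' x) s
        + ∑ k : Fin 3, (γ s i).2 k * Torus.partialDeriv k (φ s) x) * h (x - (γ s i).1)) volume a b ∧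
    ∫ s in a..b, (∫ x, ∑ i, (deriv (fun s' => φ s' x) s
        + ∑ k : Fin 3, (γ s i).2 k * Torus.partialDeriv k (φ s) x) * h (x - (γ s i).1)) =
      (∫ x, φ b x * ∑ i, h (x - (γ b i).1)) - ∫ x, φ a x * ∑ i, h (x - (γ a i).1) := by
  have hfin : ∀ a b : ℝ, (collisionTimes (Torus.geometry (Fin 3)) ε γ ∩ Set.Ioo a b).Finite := fun a b =>
    (hγ.locFinite a b).subset (Set.inter_subset_inter_right _ Set.Ioo_subset_Icc_self)
  intro m
  induction m with
  | zero =>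
    intro a b hab hcard
    have hempty : collisionTimes (Torus.geometry (Fin 3)) ε γ ∩ Set.Ioo a b = ∅ :=
      (Set.ncard_eq_zero (hfin a b)).1 (Nat.le_zero.1 hcard)
    refine ftc_free hγ hφ hh hab fun τ hτ hτC => ?_
    have hmem : τ ∈ collisionTimes (Torus.geometry (Fin 3)) ε γ ∩ Set.Ioo a b := ⟨hτC, hτ⟩
    rw [hempty] at hmem
    exact hmem
  | succ m ih =>
    intro a b hab hcard
    by_cases hex : ∃ τ ∈ Set.Ioo a b, τ ∈ collisionTimes (Torus.geometry (Fin 3)) ε γ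
    · obtain ⟨τ, hτ, hτC⟩ := hex
      have hcut : ∀ I : Set ℝ, τ ∉ I → collisionTimes (Torus.geometry (Fin 3)) ε γ ∩ I ⊆
          collisionTimes (Torus.geometry (Fin 3)) ε γ ∩ Set.Ioo a b →
          (collisionTimes (Torus.geometry (Fin 3)) ε γ ∩ I).ncard ≤ m := by
        intro I hτI hsub
        have hss : collisionTimes (Torus.geometry (Fin 3)) ε γ ∩ I ⊂
            collisionTimes (Torus.geometry (Fin 3)) ε γ ∩ Set.Ioo a b :=
          Set.ssubset_iff_subset_ne.2 ⟨hsub, fun heq => by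
            have hmem : τ ∈ collisionTimes (Torus.geometry (Fin 3)) ε γ ∩ I := by rw [heq]; exact ⟨hτC, hτ⟩
            exact hτI hmem.2⟩
        have := Set.ncard_lt_ncard hss (hfin a b)
        omega
      obtain ⟨hi1, he1⟩ := ih hτ.1.le (hcut (Set.Ioo a τ) (fun h' => lt_irrefl τ h'.2)
        (Set.inter_subset_inter_right _ (Set.Ioo_subset_Ioo_right hτ.2.le)))
      obtain ⟨hi2, he2⟩ := ih hτ.2.le (hcut (Set.Ioo τ b) (fun h' => lt_irrefl τ h'.1)
        (Set.inter_subset_inter_right _ (Set.Ioo_subset_Ioo_left hτ.1.le)))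
      refine ⟨hi1.trans hi2, ?_⟩
      rw [← intervalIntegral.integral_add_adjacent_intervals hi1 hi2, he1, he2]
      ring
    · push Not at hex
      exact ftc_free hγ hφ hh hab fun τ hτ => hex τ hτ

end Trajectory

/-- **The exact pathwise continuity equation of the cone-mollified empirical density, `C¹` space-time tests**
(stub `stub_massBalanceC1` of line `Sketch`, crux `ChaosClosesEuler`, stmt-AtomisticToContinuum-15141). Along one
good orbit `s ↦ Φ.flow s z` of the hard-sphere flow, for the `r`-cone-mollified density
`ρ_r(w)(x₀) = ∫ b_r(q.1, x₀) dμ_w` and momentum `m_r(w)(x₀) = ∫ b_r(q.1, x₀) q.2 dμ_w` and every test function `φ`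
with `C¹` space-time lift, `∫ φ(t)ρ_r(t) − ∫ φ(0)ρ_r(0) = ∫_{[0,t]} ∫ (∂ₛφ ρ_r(s) + ∑ₖ (m_r(s))ₖ ∂ₖφ(s))` — a
deterministic identity (Bogolyubov's exact weak equation for the empirical measure of one trajectory, mass
component; Pulvirenti–Simonella arXiv:1504.03215 §1 (1.3)–(1.5)): free transport between collisions, and collisions
move no mass. [folklore] -/
theorem stub_massBalanceC1 :
    ∀ (σ : ℝ), 0 < σ → σ < 2⁻¹ → ∀ (N : ℕ)
    (Φ : HardSphereFlow (Torus.geometry (Fin 3)) (hsDiameter σ N) (N + 1)),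
    ∀ z ∈ Φ.good, ∀ r : ℝ, 0 < r → r < 2⁻¹ →
    ∀ φ : ℝ → T3 → ℝ, ContDiff ℝ 1 (Literature.Analysis.FunctionSpaces.Torus.stLift φ) →
    ∀ t : ℝ, 0 ≤ t →
    let bx : T3 → T3 → ℝ := fun y x => 3 / (Real.pi * r ^ 3) * max (1 - Torus.euclidDist y x / r) 0;
    let ρm : Config (N + 1) (Fin 3) T3 → T3 → ℝ := fun w x₀ => ∫ q, bx q.1 x₀ ∂(empiricalMeasure w);
    let mm : Config (N + 1) (Fin 3) T3 → T3 → V3 := fun w x₀ => ∫ q, bx q.1 x₀ • q.2 ∂(empiricalMeasure w);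
    (∫ x, φ t x * ρm (Φ.flow t z) x) - ∫ x, φ 0 x * ρm (Φ.flow 0 z) x =
      ∫ s in Set.Icc 0 t, ∫ x, (deriv (fun s' => φ s' x) s * ρm (Φ.flow s z) x
        + ∑ k : Fin 3, mm (Φ.flow s z) x k * Literature.Analysis.FunctionSpaces.Torus.partialDeriv k (φ s) x) := by
  intro σ _hσ _hσ2 N Φ z hz r _hr _hr2 φ hφ t ht
  dsimp only
  have hγ : IsHardSphereTrajectory (Torus.geometry (Fin 3)) (hsDiameter σ N) (N + 1) (fun s => Φ.flow s z) :=
    Φ.isTrajectory z hz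
  -- the cone kernel depends on the torus difference only
  set hc : T3 → ℝ := fun w => 3 / (Real.pi * r ^ 3) * max (1 - ‖Torus.reprSym w‖ / r) 0 with hhc
  have hcont : Continuous hc :=
    continuous_const.mul ((continuous_const.sub (Torus.continuous_norm_reprSym.div_const r)).max continuous_const)
  have hbx : ∀ y x : T3, 3 / (Real.pi * r ^ 3) * max (1 - Torus.euclidDist y x / r) 0 = hc (x - y) := by
    intro y x
    rw [hhc, Torus.euclidDist_comm, Torus.euclidDist_eq]
  simp_rw [hbx, integral_empiricalMeasure, integral_empiricalMeasure_smul]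
  -- rearrangement of the finite sums
  have hL : ∀ s, (∫ x, φ s x * (((N + 1 : ℕ) : ℝ)⁻¹ * ∑ i, hc (x - (Φ.flow s z i).1))) =
      ((N + 1 : ℕ) : ℝ)⁻¹ * ∫ x, φ s x * ∑ i, hc (x - (Φ.flow s z i).1) := by
    intro s
    rw [← integral_const_mul]
    exact integral_congr_ae (ae_of_all _ fun x => by ring)
  have hR : ∀ (s : ℝ) (x : T3), deriv (fun s' => φ s' x) s * (((N + 1 : ℕ) : ℝ)⁻¹ * ∑ i, hc (x - (Φ.flow s z i).1))
      + ∑ k : Fin 3, ((((N + 1 : ℕ) : ℝ)⁻¹ • ∑ i, hc (x - (Φ.flow s z i).1) • (Φ.flow s z i).2 : V3)) k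
          * Literature.Analysis.FunctionSpaces.Torus.partialDeriv k (φ s) x =
      ((N + 1 : ℕ) : ℝ)⁻¹ * ∑ i, (deriv (fun s' => φ s' x) s
        + ∑ k : Fin 3, (Φ.flow s z i).2 k * Literature.Analysis.FunctionSpaces.Torus.partialDeriv k (φ s) x)
          * hc (x - (Φ.flow s z i).1) := by
    intro s x
    simp only [WithLp.ofLp_smul, WithLp.ofLp_sum, Finset.sum_apply, Pi.smul_apply, smul_eq_mul]
    simp only [Finset.mul_sum, Finset.sum_mul, add_mul, mul_add, Finset.sum_add_distrib]
    congr 1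
    · exact Finset.sum_congr rfl fun i _ => by ring
    · rw [Finset.sum_comm]
      exact Finset.sum_congr rfl fun i _ => Finset.sum_congr rfl fun k _ => by ring
  rw [hL t, hL 0]
  simp_rw [hR, integral_const_mul]
  rw [← mul_sub, integral_Icc_eq_integral_Ioc, ← intervalIntegral.integral_of_le ht]
  congr 1
  exact ((ftc_pieces hγ hφ hcont _ ht le_rfl).2).symm

end Summit.AtomisticToContinuum.HydrodynamicLimit.Theorems.ChaosClosesEulerMassBalanceC1
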